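/-
Origin: expansion seat `planner-pub-hodgecm-toy-g2-0`, handover #9 2026-08-18T07:15:28Z (`HOME/pub-hodgecm-toy-g2/lean/ToyG2/Universe2.lean`, md5 5ced5dd4, 257 lines);
landed by the gen-7 packager in gate run 25 as `HodgeCM/Model/ToyG2/Universe2.lean` (import ^import ToyG2\.→import HodgeCM.Model.ToyG2. ×1).
-/
/-
Copyright (c) 2026. All rights reserved.
Released under Apache 2.0 license as described in the file LICENSE.
-/
import Mathlib
import Summits.HodgeConjecture.HodgeCM.Model.ToyG2.Objects2
import Summits.HodgeConjecture.HodgeCM.Model.Toy.Toy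

/-!
# ToyG2.Universe2 — the generation-2 universe and its trace-free axioms

`toyModel2With D T pl : Universe` is the generation-2 model (`HOME/pub-hodgecm-toy-g2/DESIGN.md` §7):
varieties are the leaf families `Obj₂` of `ToyG2.Objects2` (CM atoms and Picard blocks), morphisms the
block-admissible Hodge maps `Hom₂`, `H^k(X) = ⋀^k L(X)` with the gen-1 Hodge data `D` on the expanded
object `X.toObj`, cup = wedge, algebraic := Hodge classes, `A_{(K,Φ)} := cmObj₂ K Φ` with the gen-1 CM
action, and — new — a Picard modular surface `P(L, ι₁) := pbObj (pl L ι₁)` made of one Picard block, and a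
GENUINE trace `tr := T.tr` supplied by a **trace system** `T` (a functional on every `⋀^k L(X)`, zero off
the top degree `2 dim X`).

Main result: `toyModel2_axioms_of` — **25 of the 28 fields of `ModelAxioms` hold in `toyModel2With D T pl`
for every `D`, `T`, `pl`** (and a Galois-CM-closure oracle for M17): the nineteen structural ones by the
gen-1 computations transported along `toObj` (which commutes with products and `cmObj` by `rfl`), the six
CM-specific ones (M11, M12, M15, M16, M17, M25) because the gen-1 witnesses are morphisms into block-free
objects, hence admissible (`Hom₂.ofHom`).  The three trace-dependent fields — M26 `gysin_surface`, M27
`deg_diag`, M28 `algDuality` — are displayed as hypotheses; they are the work programme of DESIGN.md §7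
(M26 by the radical-killing / weight-operator argument over `ToyG2.EquivRepr` + `ToyG2.HodgeWeight`, M27 by
`det = norm⁴` on the top exterior power, M28 by the gen-1 twisted trace-form star at the gen-2 dimension).

Also: `toyModel2With D TraceSys.zero pl` (all traces zero) satisfies M26 and M27 trivially, so the count of
unconditional fields there is 27 (`toyModel2_axioms_zero`; M28 needs the parity bookkeeping
`dim₂ (A⁴) = 2[K:ℚ]`, left to the trace programme).
-/

namespace HodgeCM.ToyG2

open HodgeCM.Toy HodgeCM.Toy.CMPresentation
open Literature.AlgebraicGeometry.Motives
open Literature.AlgebraicGeometry.Motives.HodgeStructure (EndAction conj ofRat mem_hodgeClasses_iff)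
open scoped TensorProduct
open exteriorPower Obj₂

noncomputable section

/-! ### Trace systems and block assignments -/

/-- A **trace system** on the generation-2 objects: `∫_X : ⋀^k L(X) → ℚ`, zero unless `k = 2 dim X`. -/
structure TraceSys where
  /-- the trace functional -/
  tr : ∀ (X : Obj₂) (k : ℕ), (↥(⋀[ℚ]^k X.L)) →ₗ[ℚ] ℚ
  /-- it vanishes off the top degree -/
  degree : ∀ (X : Obj₂) (k : ℕ), k ≠ 2 * X.dim → tr X k = 0

/-- the zero trace system (the gen-1 convention) -/
def TraceSys.zero : TraceSys := ⟨fun _ _ => 0, fun _ _ _ => rfl⟩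

/-- an assignment of a Picard block to every pair `(L, ι₁)` -/
abbrev PBlocks : Type 1 := ∀ (L : CMField), (L →+* ℂ) → PLeaf

/-! ### The universe -/

/-- **The generation-2 toy universe** on the Hodge data `D`, the trace system `T` and the block
assignment `pl` (reducible, so that its fields compute). -/
@[reducible] def toyModel2With (D : HodgeData) (T : TraceSys) (pl : PBlocks) : Universe where
  Var := Obj₂
  dim := Obj₂.dim
  Coh X k := ↥(⋀[ℚ]^k X.L)
  hodge X k := D.hs X.toObj k
  alg X p := (D.hs X.toObj (2 * p)).hodgeClasses (p : ℤ)
  Mor := Obj₂.Hom₂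
  idMor := Obj₂.Hom₂.id
  comp f g := f.comp g
  pull f k := map k f.lin
  cup X i j := wedge ℚ X.L i j
  tr := T.tr
  prod := Obj₂.prod
  fst := Obj₂.Hom₂.fst
  snd := Obj₂.Hom₂.snd
  IsAbelianVariety := Obj₂.IsBlockFree
  IsCMAbelianVariety X := ∃ (K : CMField) (Φ : CMType K), X = cmObj₂ K Φ
  cmAV := cmObj₂
  cmAct K Φ := cmAction K Φ D
  pms L ι₁ _ _ := pbObj (pl L ι₁)

variable (D : HodgeData) (T : TraceSys) (pl : PBlocks)

/-! ### Unfolding lemmas (all `rfl`) -/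
section unfold
variable {D T pl}
variable {X Y Z : Obj₂}

/-- (Ported verbatim from the HodgeCMPerL package; no docstring in the source.) -/
lemma Var_eq : (toyModel2With D T pl).Var = Obj₂ := rfl
/-- (Ported verbatim from the HodgeCMPerL package; no docstring in the source.) -/
lemma pull_eq (f : Hom₂ X Y) (k : ℕ) :
    (toyModel2With D T pl).pull (X := X) (Y := Y) f k = map k f.lin := rfl
/-- (Ported verbatim from the HodgeCMPerL package; no docstring in the source.) -/
lemma comp_eq (f : Hom₂ X Y) (g : Hom₂ Y Z) :
    (toyModel2With D T pl).comp (X := X) (Y := Y) (Z := Z) f g = f.comp g := rfl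
/-- (Ported verbatim from the HodgeCMPerL package; no docstring in the source.) -/
lemma cup_eq (X : Obj₂) (i j : ℕ) : (toyModel2With D T pl).cup X i j = wedge ℚ X.L i j := rfl
/-- (Ported verbatim from the HodgeCMPerL package; no docstring in the source.) -/
lemma tr_eq (X : Obj₂) (k : ℕ) : (toyModel2With D T pl).tr X k = T.tr X k := rfl
/-- (Ported verbatim from the HodgeCMPerL package; no docstring in the source.) -/
lemma alg_eq (X : Obj₂) (p : ℕ) :
    (toyModel2With D T pl).alg X p = (D.hs X.toObj (2 * p)).hodgeClasses (p : ℤ) := rfl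
/-- (Ported verbatim from the HodgeCMPerL package; no docstring in the source.) -/
lemma dim_eq (X : Obj₂) : (toyModel2With D T pl).dim X = X.dim := rfl
/-- (Ported verbatim from the HodgeCMPerL package; no docstring in the source.) -/
lemma cmAV_eq (K : CMField) (Φ : CMType K) : (toyModel2With D T pl).cmAV K Φ = cmObj₂ K Φ := rfl
/-- (Ported verbatim from the HodgeCMPerL package; no docstring in the source.) -/
lemma pms_eq (L : CMField) (ι₁ : L →+* ℂ) (V : HermSpace3 L ι₁) (Γ : Level V) :
    (toyModel2With D T pl).pms L ι₁ V Γ = pbObj (pl L ι₁) := rfl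
/-- (Ported verbatim from the HodgeCMPerL package; no docstring in the source.) -/
lemma toObj_prod4 (K : CMField) (Φ : Fin 4 → CMType K) :
    ((toyModel2With D T pl).prod4 K Φ).toObj = (toyModelWith D).prod4 K Φ := rfl
/-- (Ported verbatim from the HodgeCMPerL package; no docstring in the source.) -/
lemma pr4_hom (K : CMField) (Φ : Fin 4 → CMType K) (i : Fin 4) :
    ((toyModel2With D T pl).pr4 K Φ i).hom = (toyModelWith D).pr4 K Φ i := by
  fin_cases i <;> rfl

end unfold

/-! ### M1–M10 -/

/-- (Ported verbatim from the HodgeCMPerL package; no docstring in the source.) -/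
theorem fact_pull_id : (toyModel2With D T pl).Fact_pull_id := fun _ _ => map_id

/-- (Ported verbatim from the HodgeCMPerL package; no docstring in the source.) -/
theorem fact_pull_comp : (toyModel2With D T pl).Fact_pull_comp := fun _ _ _ _ _ _ => map_comp _ _

/-- (Ported verbatim from the HodgeCMPerL package; no docstring in the source.) -/
theorem fact_pull_cup : (toyModel2With D T pl).Fact_pull_cup := fun _ _ f i j x y =>
  map_wedge i j f.lin x y

/-- (Ported verbatim from the HodgeCMPerL package; no docstring in the source.) -/
theorem fact_pull_hodge : (toyModel2With D T pl).Fact_pull_hodge := fun _ _ f k p => D.natural f.hom k p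

/-- (Ported verbatim from the HodgeCMPerL package; no docstring in the source.) -/
theorem fact_cup2_hodge : (toyModel2With D T pl).Fact_cup2_hodge := fun X k p q x y hx hy =>
  D.mul X.toObj k p q x y hx hy

/-- (Ported verbatim from the HodgeCMPerL package; no docstring in the source.) -/
theorem fact_tr_degree : (toyModel2With D T pl).Fact_tr_degree := fun X k hk => T.degree X k hk

/-- (Ported verbatim from the HodgeCMPerL package; no docstring in the source.) -/
theorem fact_alg_le_hodge : (toyModel2With D T pl).Fact_alg_le_hodge := fun _ _ => le_rfl

/-- (Ported verbatim from the HodgeCMPerL package; no docstring in the source.) -/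
theorem fact_lefschetz11 : (toyModel2With D T pl).Fact_Lefschetz11 := fun _ => le_rfl

/-- (Ported verbatim from the HodgeCMPerL package; no docstring in the source.) -/
theorem fact_pull_alg : (toyModel2With D T pl).Fact_pull_alg := by
  intro X Y f p v hv
  obtain ⟨w, hw, rfl⟩ := Submodule.mem_map.mp hv
  change w ∈ (D.hs Y.toObj (2 * p)).hodgeClasses (p : ℤ) at hw
  change map (2 * p) f.lin w ∈ (D.hs X.toObj (2 * p)).hodgeClasses (p : ℤ)
  rw [mem_hodgeClasses_iff] at hw ⊢
  refine D.natural f.hom (2 * p) p ⟨ofRat w, hw, ?_⟩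
  simp [LinearMap.baseChange_tmul]

/-- (Ported verbatim from the HodgeCMPerL package; no docstring in the source.) -/
theorem fact_cup_alg : (toyModel2With D T pl).Fact_cup_alg := by
  intro X x y hx hy
  change x ∈ (D.hs X.toObj (2 * 1)).hodgeClasses ((1 : ℕ) : ℤ) at hx
  change y ∈ (D.hs X.toObj (2 * 1)).hodgeClasses ((1 : ℕ) : ℤ) at hy
  change wedge ℚ X.L 2 2 x y ∈ (D.hs X.toObj (2 * 2)).hodgeClasses ((2 : ℕ) : ℤ)
  rw [mem_hodgeClasses_iff] at hx hy ⊢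
  have h := D.mul X.toObj 2 1 1 (ofRat x) (ofRat y) hx hy
  have e : LinearMap.BilinMap.baseChange ℂ (wedge ℚ X.L 2 2) (ofRat x) (ofRat y)
      = ofRat (wedge ℚ X.L 2 2 x y) := by
    simp [LinearMap.BilinMap.baseChange_tmul]
  rw [e] at h
  simpa using h

/-! ### M14, the surface dimension, M18–M24 -/

/-- (Ported verbatim from the HodgeCMPerL package; no docstring in the source.) -/
theorem fact_cmAV : (toyModel2With D T pl).Fact_cmAV := fun K Φ =>
  ⟨isBlockFree_cmObj₂ K Φ, ⟨K, Φ, rfl⟩, dim_cmObj₂ K Φ⟩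

/-- (Ported verbatim from the HodgeCMPerL package; no docstring in the source.) -/
theorem fact_pms_dim : (toyModel2With D T pl).PmsDimTwo := fun L ι₁ _ _ => dim_pbObj (pl L ι₁)

/-- (Ported verbatim from the HodgeCMPerL package; no docstring in the source.) -/
theorem fact_lift : (toyModel2With D T pl).Fact_lift := fun _ _ _ f g =>
  ⟨Hom₂.lift f g, Hom₂.lift_comp_fst f g, Hom₂.lift_comp_snd f g⟩

/-- (Ported verbatim from the HodgeCMPerL package; no docstring in the source.) -/
theorem fact_cup_comm1 : (toyModel2With D T pl).Fact_cup_comm1 := fun _ a b => wedge_comm_one a b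

/-- (Ported verbatim from the HodgeCMPerL package; no docstring in the source.) -/
theorem fact_cup_interchange : (toyModel2With D T pl).Fact_cup_interchange := fun _ a b c d =>
  wedge_interchange a b c d

/-- (Ported verbatim from the HodgeCMPerL package; no docstring in the source.) -/
theorem fact_kunneth1 : (toyModel2With D T pl).Fact_kunneth1 := fun X Y =>
  HodgeCM.Toy.fact_kunneth1 D X.toObj Y.toObj

/-- (Ported verbatim from the HodgeCMPerL package; no docstring in the source.) -/
theorem fact_H1_rank : (toyModel2With D T pl).Fact_H1_rank := fun K Φ =>
  HodgeCM.Toy.fact_H1_rank D K Φ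

/-- (Ported verbatim from the HodgeCMPerL package; no docstring in the source.) -/
theorem fact_H4_span : (toyModel2With D T pl).Fact_H4_span := fun _ _ => span_wedge4_eq_top

/-- (Ported verbatim from the HodgeCMPerL package; no docstring in the source.) -/
theorem fact_cmEnd : (toyModel2With D T pl).Fact_cmEnd := fun K Φ a =>
  ⟨Hom₂.ofHom (mulHom K Φ (a : K)) (isBlockFree_cmObj₂ K Φ), (cmι_apply K Φ (a : K)).symm⟩

/-! ### The CM-specific fields M11, M12, M15, M16, M17, M25 (transported from generation 1) -/

/-- (Ported verbatim from the HodgeCMPerL package; no docstring in the source.) -/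
theorem fact_eigenLine : (toyModel2With D T pl).Fact_eigenLine := fun K Φ σ =>
  HodgeCM.Toy.fact_eigenLine D K Φ σ

/-- (Ported verbatim from the HodgeCMPerL package; no docstring in the source.) -/
theorem fact_alphaLine : (toyModel2With D T pl).Fact_alphaLine := fun K Φ σ =>
  HodgeCM.Toy.fact_alphaLine D K Φ σ

/-- (Ported verbatim from the HodgeCMPerL package; no docstring in the source.) -/
theorem fact_weilLine_rank : (toyModel2With D T pl).Fact_weilLine_rank := fun K Φ =>
  HodgeCM.Toy.fact_weilLine_rank D K Φ

/-- (Ported verbatim from the HodgeCMPerL package; no docstring in the source.) -/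
theorem fact_weilLine_hodge : (toyModel2With D T pl).Fact_weilLine_hodge := fun K f =>
  HodgeCM.Toy.fact_weilLine_hodge D K f

/-- (Ported verbatim from the HodgeCMPerL package; no docstring in the source.) -/
theorem fact_conjIsogeny : (toyModel2With D T pl).Fact_conjIsogeny := by
  intro K Φ Φ' h
  obtain ⟨u, hu, hu'⟩ := HodgeCM.Toy.fact_conjIsogeny D K Φ Φ' h
  exact ⟨Hom₂.ofHom u (isBlockFree_cmObj₂ K Φ'), hu, hu'⟩

/-- (Ported verbatim from the HodgeCMPerL package; no docstring in the source.) -/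
theorem fact_cmDominated (O : GaloisCMOracle) : (toyModel2With D T pl).Fact_cmDominated := by
  rintro X ⟨K, Φ, rfl⟩
  refine ⟨O.F K, O.gal K, O.six K, 0, fun _ => inducedType K (O.F K) (O.emb K) Φ,
    Hom₂.ofHom (sHom K (O.F K) (O.emb K) Φ) (isBlockFree_cmObj₂ _ _),
    Hom₂.ofHom (piHom K (O.F K) (O.emb K) Φ) (isBlockFree_cmObj₂ _ _), 1, one_ne_zero, fun k => ?_⟩
  change map k ((sHom K (O.F K) (O.emb K) Φ).comp (piHom K (O.F K) (O.emb K) Φ)).lin = _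
  rw [sHom_comp_piHom, Nat.cast_one, one_pow, one_smul]
  exact map_id

/-! ### Assembly -/

/-- **25 of the 28 model axioms hold in `toyModel2With D T pl`** for every Hodge datum, trace system and
block assignment (M17 from a Galois-CM-closure oracle); the three trace-dependent fields M26, M27, M28 are
displayed as hypotheses. -/
theorem toyModel2_axioms_of (O : GaloisCMOracle)
    (h26 : (toyModel2With D T pl).Fact_gysin_surface)
    (h27 : (toyModel2With D T pl).Fact_deg_diag)
    (h28 : (toyModel2With D T pl).Fact_algDuality) : (toyModel2With D T pl).ModelAxioms where
  pull_id := fact_pull_id D T pl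
  pull_comp := fact_pull_comp D T pl
  pull_cup := fact_pull_cup D T pl
  pull_hodge := fact_pull_hodge D T pl
  cup2_hodge := fact_cup2_hodge D T pl
  tr_degree := fact_tr_degree D T pl
  alg_le_hodge := fact_alg_le_hodge D T pl
  pull_alg := fact_pull_alg D T pl
  cup_alg := fact_cup_alg D T pl
  lefschetz11 := fact_lefschetz11 D T pl
  cmAV := fact_cmAV D T pl
  eigenLine := fact_eigenLine D T pl
  alphaLine := fact_alphaLine D T pl
  cmDominated := fact_cmDominated D T pl O
  weilLine_rank := fact_weilLine_rank D T pl
  weilLine_hodge := fact_weilLine_hodge D T pl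
  pms_dim := fact_pms_dim D T pl
  lift := fact_lift D T pl
  cup_comm1 := fact_cup_comm1 D T pl
  cup_interchange := fact_cup_interchange D T pl
  kunneth1 := fact_kunneth1 D T pl
  H1_rank := fact_H1_rank D T pl
  H4_span := fact_H4_span D T pl
  cmEnd := fact_cmEnd D T pl
  conjIsogeny := fact_conjIsogeny D T pl
  gysin_surface := h26
  deg_diag := h27
  algDuality := h28

/-- With the zero trace system M26 and M27 hold trivially (as in generation 1). -/
theorem toyModel2_axioms_zero (O : GaloisCMOracle)
    (h28 : (toyModel2With D TraceSys.zero pl).Fact_algDuality) :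
    (toyModel2With D TraceSys.zero pl).ModelAxioms :=
  toyModel2_axioms_of D TraceSys.zero pl O (fun _ _ _ _ => ⟨0, Submodule.zero_mem _, fun _ => rfl⟩)
    (fun K Φ a M _ k => by
      change (0 : _ →ₗ[ℚ] ℚ) ∘ₗ _ = (Algebra.norm ℚ a) ^ 4 • (0 : _ →ₗ[ℚ] ℚ)
      rw [LinearMap.zero_comp, smul_zero]) h28

end

end HodgeCM.ToyG2
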